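import Summits.QuantumFields.BalabanUV.Beta.NVertexWoundLimit
import Summits.QuantumFields.BalabanUV.Beta.FP.KernelPeriodisationFibHessKer

/-!
# `BalabanUV.Beta.FP.KernelPeriodisationFibWoundLimit` — row D1 ∕ (C1), PART 15b: **THE WINDING-LIMIT LEMMA** — along growing boxes, the torus
# tadpole trace of a SOURCE-WOUND family `Σ'_e V (s₀ + Mc_k∘e)` of insertions, all bi-localised at the same points with separation-decaying
# constants, tends to the lattice tadpole of its unwound member `V s₀`; corollary: the WINDING LETTER `hW?w` of the law v-next
# `FP/TowerKernelLawNamedC` ∕ the END wrapper v5 in leaf-06's generic currency (an2 g67 J-NOTE-7 ∕ J-NOTE-8, journal l.67681 ∕ l.67705; road FP g43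
# SPEC-55 §3–§4, A-2 l.67713; the bricks are PART 15a `Beta/NVertexWoundLimit`)

WHY.  Decision (R1) «wound rows» (road FP g42 A-1 l.67696): the second-order torus rows of the tower carry, per box `k`, the periodisation of the
WOUND family `𝒲♭ k := x z a b ↦ Σ'_e 𝒲 μ 0 ν (z + Mc_k∘e) x z a b` (all windings `e` of the second source around the coarse torus `Mc k`), and the
law v-next `TowerKernelLawNamedC.hessKer_law_tower_namedC` displays ONE winding letter per system,
`Tendsto (k ↦ trace (perF T_k A * perF T_k (dper T_k (𝒲♭ k))) − trace (perF T_k A * perF T_k (dper T_k (𝒲 μ 0 ν z)))) atTop (𝓝 0)`.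
Under the ADOPTED separation letter (road's answer to Q-an2-g67-3, SPEC-55 §3: FIRST-SOURCE-LOCALISED, both legs at the fixed points `(p, q)`,
the separation only in the constant) `∀ s, BiLoc (V s) p q (Cw·e^{−δs·|N•s − p₀|₁}) δ`, EVERY member of the wound family is bi-localised at the SAME
points, so the wound SUM is itself bi-localised at `(p, q)` with constant `Σ'_e ε_k(e) ≤ |Cw|·K_{d+1}(δs)` UNIFORMLY in the box (§1) — leaf-06's
one-insertion wrap-around (`KernelPeriodisationFibTraceTwoBound.abs_trace_tadpole_sub_tr_le`) then applies to the whole sum at once, and all `tsum`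
exchanges happen on the LATTICE side (§2: `tadpole A (Σ' W) = Σ' tadpole A W`, two Fubini steps with joint summability from `Summable.mul_of_nonneg`);
the `e ≠ 0` tail is ONE geometric series (PART 15a `exp_neg_l1_translate_le_of_ne_zero` + leaf-06 `summable_exp_l1_translate`), its ε-step is
leaf-06's `tendsto_of_wrapAround` on the source boxes `Mc`.

WHAT ([folklore] `tsum` bookkeeping + one geometric series BY NAME; generic fibre `F`, dimension `d`; no `def`, no `def … : Prop`, nothing cited,
0 sorry): §1 `summable_apply_of_biLoc`, **`biLoc_tsum`**; §2 `comp_tsum_apply`, `tr_tsum`, **`tadpole_tsum`**; §3 **`tendsto_trace_tadpole_tsum`**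
(the abstract limit: boxes `T k` growing, `A` decaying and `T_kℤ`-invariant, members `W k e` bi-localised at `(p,q)` with constants `ε k e`,
`W k 0 = V`, `Σ'_e ε k e ≤ Cε`, `Σ'_{e ≠ 0} ε k e → 0` ⟹ `trace (perF (T k) A * perF (T k) (dper (T k) (Σ'_e W k e))) → tadpole A V`);
§4 `zsmul_translate_sub`, **`tendsto_trace_tadpole_translate`** (= (ii) of J-NOTE-8 VERBATIM under the adopted letter, for the source-wound family
`Σ'_e V (translate (Mc k) s₀ e)`), **`winding_letter_translate`** (NamedC's ∕ v5's `hW?w` SHAPE: the difference with the unwound trace is a null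
sequence — §4 `.sub` leaf-06 `tendsto_trace_tadpole'`), so the road's instantiation is ONE term.
WHAT THIS IS NOT: not the separation letter's discharge for the (C1) family `WN♮` (corollary of lit `CombHId2W2SymSwap.exists_farSmall_W2OfK`, sequel);
no row of the END wrapper discharged here; nothing of Bałaban's asserted, valued or discharged; 0 estimates beyond [folklore] geometric series;
0∕4 row-D1 binders (hW, hR, D1Tel, D1Rep); ROOT M‴ p325680 ∕ P5c ∕ D6 untouched; NOT (C1), NOT (T-ID), NOT D1, NEVER «G-an2-4 closed», NOT BetaPertH,
NOT continuum, NOT Clay.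

HONEST DEPENDENCY (page 1, mandatory): continuum YM on T⁴ ⇐ BetaPertH ∧ nine spine estimates (0/9 proved); BetaPertH ⇐ (D1) ∧ (D4) ∧ CAP+tail;
G-an2-4 gates asym, D1 and NE2/3/4.  HONEST FRAMING (cell contract, verbatim): «discharging `BetaPertH` makes Bałaban's UV stability UNCONDITIONAL —
a real constructive-QFT result; it is NOT the continuum limit and NOT the Clay problem.»  ABSOLUTE RULE (cell charter, verbatim): «No internally-minted
statement may enter as a cited fact. Every hypothesis is either kernel-proved in this package or a verbatim quotation of a PUBLISHED theorem with page
reference. The manuscript(s) under audit are NOT citable for their own disputed steps — they are the thing under adjudication; programme-internal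
(2001/route/tribunal) claims are never citable.»  Row D1 ∕ (C1) OWNER an2 (b2b-balaban-beta-an2) gen 68, 2026-08-27.  No existing file touched.
-/

noncomputable section

open scoped BigOperators Matrix Topology
open Finset Filter

namespace Summit.QuantumFields.BalabanUV.Beta.FP.KernelPeriodisationFibWoundLimit

open Literature.MathematicalPhysics.QuantumFieldTheory.Balaban1983to89
open Literature.MathematicalPhysics.QuantumFieldTheory.Balaban1983to89.Beta
open B12Sec2to5 (l1 l1_nonneg)
open B4TorusKernel.MultiPeriod (translate translate_apply)
open B4Sect5Proof (latticeConst latticeConst_nonneg)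
open ExpKernelCalculus (MKer Decays BiLoc tr tadpole Zl Zl_nonneg summable_exp_shift' abs_tadpole_le biLoc_comp_decays abs_trTerm_le)
open OneStepResolventKernel (biLoc_mono decays_mono)
open Summit.QuantumFields.BalabanUV.Beta.GAN24.DirichletExhaustionDeperiodise (translate_zero)
open Summit.QuantumFields.BalabanUV.Beta.FP.KernelPeriodisationFib (perF)
open Summit.QuantumFields.BalabanUV.Beta.FP.KernelPeriodisationFibLoc (dper summable_exp_l1_translate)
open Summit.QuantumFields.BalabanUV.Beta.FP.KernelPeriodisationFibTrace (translate_sub_self)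
open Summit.QuantumFields.BalabanUV.Beta.FP.KernelPeriodisationFibTraceTwoBound (abs_trace_tadpole_sub_tr_le)
open Summit.QuantumFields.BalabanUV.Beta.FP.KernelPeriodisationFibHessKer (tendsto_of_wrapAround tendsto_trace_tadpole')
open Summit.QuantumFields.BalabanUV.Beta.NVertexWoundLimit (exp_neg_l1_translate_le_of_ne_zero)

variable {d : ℕ} {F : Type*}

/-! ## §1 A family of kernels bi-localised at the SAME points sums to a kernel bi-localised there -/

section Sum

variable {ι : Type*} {W : ι → MKer (d + 1) F} {p q : Fin (d + 1) → ℤ} {ε : ι → ℝ} {δ : ℝ}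

/-- [folklore] members bi-localised at `(p,q)` with summable constants: the family is summable ENTRYWISE. -/
theorem summable_apply_of_biLoc (hW : ∀ e, BiLoc (W e) p q (ε e) δ) (hε : Summable ε) (x z : Fin (d + 1) → ℤ) (a b : F) :
    Summable fun e => W e x z a b :=
  .of_norm_bounded (hε.mul_right _) fun e => by rw [Real.norm_eq_abs]; exact hW e x z a b

/-- [folklore] **`biLoc_tsum`** — a family ALL of whose members are bi-localised at the SAME points `(p, q)`, rate `δ`, with summable constants
`ε e`, sums (entrywise `Σ'`) to a kernel bi-localised at `(p, q)`, rate `δ`, constant `Σ'_e ε e`. -/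
theorem biLoc_tsum (hW : ∀ e, BiLoc (W e) p q (ε e) δ) (hε : Summable ε) :
    BiLoc (fun x z a b => ∑' e, W e x z a b) p q (∑' e, ε e) δ := by
  intro x z a b
  have h := tsum_of_norm_bounded (hε.mul_right (Real.exp (-δ * (l1 (x - p) + l1 (z - q))))).hasSum
    (fun e => by rw [Real.norm_eq_abs]; exact hW e x z a b)
  rw [Real.norm_eq_abs, tsum_mul_right] at h
  exact h

end Sum

/-! ## §2 The lattice tadpole of an entrywise sum: two Fubini steps -/

section Tadpole

variable [Fintype F] {ι : Type*} {A : MKer (d + 1) F} {CA α : ℝ} {W : ι → MKer (d + 1) F} {p q : Fin (d + 1) → ℤ} {ε : ι → ℝ} {δ : ℝ}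

/-- [folklore] **composition through an entrywise sum**: for a decaying leg `A` and members bi-localised at `(p,q)` with summable constants,
`(A ⋆ Σ'_e W e) x z a b = Σ'_e (A ⋆ W e) x z a b` (Fubini on `(y, e)`: the summand is `≤ |F|·CA·ε e·e^{−δ|y − p|}`). -/
theorem comp_tsum_apply (hA : Decays A CA α) (hα : 0 ≤ α) (hW : ∀ e, BiLoc (W e) p q (ε e) δ) (hε : Summable ε) (hδ : 0 < δ)
    (x z : Fin (d + 1) → ℤ) (a b : F) :
    ExpKernelCalculus.comp A (fun x z a b => ∑' e, W e x z a b) x z a b = ∑' e, ExpKernelCalculus.comp A (W e) x z a b := by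
  have hCA : 0 ≤ CA := hA.nonneg a
  have hε0 : ∀ e, 0 ≤ ε e := fun e => (hW e).nonneg a
  -- termwise majorant of the `(y, e)` family
  have hterm : ∀ (y : Fin (d + 1) → ℤ) (e : ι),
      |∑ f, A x y a f * W e y z f b| ≤ Real.exp (-δ * l1 (y - p)) * ((Fintype.card F : ℝ) * CA * ε e) := fun y e => by
    calc |∑ f, A x y a f * W e y z f b| ≤ ∑ f, |A x y a f * W e y z f b| := Finset.abs_sum_le_sum_abs _ _
      _ ≤ ∑ _f : F, CA * (ε e * Real.exp (-δ * l1 (y - p))) := Finset.sum_le_sum fun f _ => by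
          rw [abs_mul]
          refine mul_le_mul ((hA x y a f).trans ?_) ((hW e y z f b).trans ?_) (abs_nonneg _) hCA
          · exact mul_le_of_le_one_right hCA (Real.exp_le_one_iff.2 (by nlinarith [l1_nonneg (x - y)]))
          · exact mul_le_mul_of_nonneg_left (Real.exp_le_exp.2 (by nlinarith [l1_nonneg (z - q), l1_nonneg (y - p)])) (hε0 e)
      _ = Real.exp (-δ * l1 (y - p)) * ((Fintype.card F : ℝ) * CA * ε e) := by
          rw [Finset.sum_const, Finset.card_univ, nsmul_eq_mul]; ring
  have hmaj : Summable fun ye : (Fin (d + 1) → ℤ) × ι => Real.exp (-δ * l1 (ye.1 - p)) * ((Fintype.card F : ℝ) * CA * ε ye.2) :=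
    (summable_exp_shift' hδ p).mul_of_nonneg (hε.mul_left _) (fun _ => (Real.exp_pos _).le)
      (fun e => mul_nonneg (mul_nonneg (Nat.cast_nonneg _) hCA) (hε0 e))
  have hG : Summable (Function.uncurry fun (y : Fin (d + 1) → ℤ) (e : ι) => ∑ f, A x y a f * W e y z f b) :=
    .of_norm_bounded hmaj fun ye => by rw [Real.norm_eq_abs]; exact hterm ye.1 ye.2
  have hWs : ∀ (y : Fin (d + 1) → ℤ) (f : F), Summable fun e => W e y z f b := fun y f => summable_apply_of_biLoc hW hε y z f b
  show (∑' y, ∑ f, A x y a f * ∑' e, W e y z f b) = ∑' e, ∑' y, ∑ f, A x y a f * W e y z f b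
  calc (∑' y, ∑ f, A x y a f * ∑' e, W e y z f b)
      = ∑' y, ∑' e, ∑ f, A x y a f * W e y z f b := by
        refine tsum_congr fun y => ?_
        calc ∑ f, A x y a f * ∑' e, W e y z f b = ∑ f, ∑' e, A x y a f * W e y z f b :=
              Finset.sum_congr rfl fun f _ => tsum_mul_left.symm
          _ = ∑' e, ∑ f, A x y a f * W e y z f b :=
              (Summable.tsum_finsetSum fun f _ => (hWs y f).mul_left (A x y a f)).symm
    _ = ∑' e, ∑' y, ∑ f, A x y a f * W e y z f b := hG.tsum_comm.symm

/-- [folklore] **the trace of an entrywise sum**: members bi-localised at `(p,q)`, rate `γ > 0`, summable constants `c e` ⟹ `e ↦ tr (K e)` is summable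
and `tr (Σ'_e K e) = Σ'_e tr (K e)` (Fubini on `(x, e)`: the diagonal term is `≤ |F|·c e·e^{−(γ∕2)|x − p|}` by `abs_trTerm_le`). -/
theorem tr_tsum {K : ι → MKer (d + 1) F} {c : ι → ℝ} {γ : ℝ} (hK : ∀ e, BiLoc (K e) p q (c e) γ) (hc : Summable c) (hγ : 0 < γ) :
    Summable (fun e => tr (K e)) ∧ tr (fun x z a b => ∑' e, K e x z a b) = ∑' e, tr (K e) := by
  rcases isEmpty_or_nonempty F with hF | ⟨⟨a₀⟩⟩
  · have h0 : ∀ L : MKer (d + 1) F, tr L = 0 := fun L => by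
      simp only [ExpKernelCalculus.tr, Finset.univ_eq_empty, Finset.sum_empty, tsum_zero]
    simp only [h0, tsum_zero]
    exact ⟨summable_zero, trivial⟩
  have hc0 : ∀ e, 0 ≤ c e := fun e => (hK e).nonneg a₀
  have hterm : ∀ (x : Fin (d + 1) → ℤ) (e : ι),
      |∑ a, K e x x a a| ≤ Real.exp (-(γ / 2) * l1 (x - p)) * ((Fintype.card F : ℝ) * c e) := fun x e => by
    refine (abs_trTerm_le (hK e) hγ.le x).trans ?_
    have h1 : Real.exp (-(γ / 2) * l1 (p - q)) ≤ 1 := Real.exp_le_one_iff.2 (by nlinarith [l1_nonneg (p - q)])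
    have h2 : 0 ≤ (Fintype.card F : ℝ) * c e := mul_nonneg (Nat.cast_nonneg _) (hc0 e)
    calc (Fintype.card F : ℝ) * c e * Real.exp (-(γ / 2) * l1 (p - q)) * Real.exp (-(γ / 2) * l1 (x - p))
        ≤ (Fintype.card F : ℝ) * c e * 1 * Real.exp (-(γ / 2) * l1 (x - p)) :=
          mul_le_mul_of_nonneg_right (mul_le_mul_of_nonneg_left h1 h2) (Real.exp_pos _).le
      _ = Real.exp (-(γ / 2) * l1 (x - p)) * ((Fintype.card F : ℝ) * c e) := by ring
  have hmaj : Summable fun xe : (Fin (d + 1) → ℤ) × ι => Real.exp (-(γ / 2) * l1 (xe.1 - p)) * ((Fintype.card F : ℝ) * c xe.2) :=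
    (summable_exp_shift' (half_pos hγ) p).mul_of_nonneg (hc.mul_left _) (fun _ => (Real.exp_pos _).le)
      (fun e => mul_nonneg (Nat.cast_nonneg _) (hc0 e))
  have hG : Summable (Function.uncurry fun (x : Fin (d + 1) → ℤ) (e : ι) => ∑ a, K e x x a a) :=
    .of_norm_bounded hmaj fun xe => by rw [Real.norm_eq_abs]; exact hterm xe.1 xe.2
  have hKs : ∀ (x : Fin (d + 1) → ℤ) (a : F), Summable fun e => K e x x a a := fun x a => summable_apply_of_biLoc hK hc x x a a
  refine ⟨hG.prod_symm.prod, ?_⟩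
  show (∑' x, ∑ a, ∑' e, K e x x a a) = ∑' e, ∑' x, ∑ a, K e x x a a
  calc (∑' x, ∑ a, ∑' e, K e x x a a) = ∑' x, ∑' e, ∑ a, K e x x a a :=
        tsum_congr fun x => (Summable.tsum_finsetSum fun a _ => hKs x a).symm
    _ = ∑' e, ∑' x, ∑ a, K e x x a a := hG.tsum_comm.symm

/-- [folklore] **`tadpole_tsum` — THE LATTICE TADPOLE OF AN ENTRYWISE SUM**: for a decaying leg `A` (rate `α > 0`) and members `W e` bi-localised at
`(p, q)` (rate `δ > 0`) with summable constants, `e ↦ tadpole A (W e)` is summable and `tadpole A (Σ'_e W e) = Σ'_e tadpole A (W e)`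
(`comp_tsum_apply`, then `tr_tsum` at the bi-localisation `biLoc_comp_decays` of `A ⋆ W e`, common rate `min α δ ∕ 2`). -/
theorem tadpole_tsum (hA : Decays A CA α) (hα : 0 < α) (hW : ∀ e, BiLoc (W e) p q (ε e) δ) (hε : Summable ε) (hδ : 0 < δ) :
    Summable (fun e => tadpole A (W e)) ∧
      tadpole A (fun x z a b => ∑' e, W e x z a b) = ∑' e, tadpole A (W e) := by
  rcases isEmpty_or_nonempty F with hF | ⟨⟨a₀⟩⟩
  · have h0 : ∀ L : MKer (d + 1) F, tadpole A L = 0 := fun L => by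
      simp only [ExpKernelCalculus.tadpole, ExpKernelCalculus.tr, Finset.univ_eq_empty, Finset.sum_empty, tsum_zero]
    simp only [h0, tsum_zero]
    exact ⟨summable_zero, trivial⟩
  have hCA : 0 ≤ CA := hA.nonneg a₀
  have hε0 : ∀ e, 0 ≤ ε e := fun e => (hW e).nonneg a₀
  have hγ : 0 < min α δ := lt_min hα hδ
  -- each `A ⋆ W e` is bi-localised at `(p, q)`, rate `min α δ ∕ 2`, constant linear in `ε e`
  have hAW : ∀ e, BiLoc (ExpKernelCalculus.comp A (W e)) p q
      ((Fintype.card F : ℝ) * (CA * ε e) * Zl (d + 1) (min α δ - min α δ / 2)) (min α δ / 2) := fun e =>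
    biLoc_comp_decays (decays_mono hA hCA le_rfl (min_le_left α δ)) (biLoc_mono (hW e) (hε0 e) (min_le_right α δ))
      (half_pos hγ).le (half_lt_self hγ)
  have hcs : Summable fun e => (Fintype.card F : ℝ) * (CA * ε e) * Zl (d + 1) (min α δ - min α δ / 2) := by
    have h := (hε.mul_left ((Fintype.card F : ℝ) * CA)).mul_right (Zl (d + 1) (min α δ - min α δ / 2))
    refine h.congr fun e => ?_
    ring
  obtain ⟨hs, htr⟩ := tr_tsum hAW hcs (half_pos hγ)
  refine ⟨hs, ?_⟩
  have hfun : ExpKernelCalculus.comp A (fun x z a b => ∑' e, W e x z a b) = fun x z a b => ∑' e, ExpKernelCalculus.comp A (W e) x z a b := by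
    funext x z a b; exact comp_tsum_apply hA hα.le hW hε hδ x z a b
  show tr (ExpKernelCalculus.comp A (fun x z a b => ∑' e, W e x z a b)) = ∑' e, tr (ExpKernelCalculus.comp A (W e))
  rw [hfun, htr]

end Tadpole

/-! ## §3 The abstract winding limit: a box-dependent family bi-localised at `(p, q)` with a vanishing `e ≠ 0` tail -/

section Limit

variable [Fintype F] {A : MKer (d + 1) F} {CA α : ℝ} {p q : Fin (d + 1) → ℤ} {δ Cε : ℝ}

/-- [folklore] **`tendsto_trace_tadpole_tsum` — THE ABSTRACT WINDING-LIMIT LEMMA.**  Boxes `T k` growing (`∀ N, ∀ᶠ k, ∀ i, N ≤ T k i`), a decaying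
`T_kℤ`-invariant leg `A`, and per box a family `W k e` (`e : ℤ^{d+1}`) whose members are ALL bi-localised at `(p, q)`, rate `δ`, with constants `ε k e`
such that `Σ'_e ε k e ≤ Cε` uniformly and the `e ≠ 0` tail `Σ'_e [e ≠ 0] ε k e → 0`, the `e = 0` member being a FIXED kernel `V`; then
`trace (perF (T k) A * perF (T k) (dper (T k) (Σ'_e W k e))) → tadpole A V`.  Proof: the wound sum is `BiLoc … p q Cε δ` (§1), so leaf-06's
`abs_trace_tadpole_sub_tr_le` + `tendsto_of_wrapAround` give `trace(…) − tadpole A (Σ'_e W k e) → 0`; `tadpole A (Σ'_e W k e) − tadpole A V =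
Σ'_{e ≠ 0} tadpole A (W k e)` (§2 + `Summable.tsum_eq_add_tsum_ite`) is `≤ Ct·Σ'_{e ≠ 0} ε k e → 0` by lit `abs_tadpole_le`. -/
theorem tendsto_trace_tadpole_tsum (T : ℕ → (Fin (d + 1) → ℕ)) [∀ k μ, NeZero (T k μ)]
    (hT : ∀ N : ℕ, ∀ᶠ k in atTop, ∀ i, N ≤ T k i) (hA : Decays A CA α) (hα : 0 < α)
    (hAinv : ∀ k (m x y : Fin (d + 1) → ℤ) (a b : F), A (translate (T k) x m) (translate (T k) y m) a b = A x y a b)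
    (W : ℕ → (Fin (d + 1) → ℤ) → MKer (d + 1) F) (V : MKer (d + 1) F) (hW0 : ∀ k, W k 0 = V)
    (ε : ℕ → (Fin (d + 1) → ℤ) → ℝ) (hW : ∀ k e, BiLoc (W k e) p q (ε k e) δ) (hδ : 0 < δ)
    (hεs : ∀ k, Summable (ε k)) (hεle : ∀ k, ∑' e, ε k e ≤ Cε)
    (hεlim : Tendsto (fun k => ∑' e, if e = 0 then (0 : ℝ) else ε k e) atTop (𝓝 0)) :
    Tendsto (fun k => Matrix.trace (perF (T k) A * perF (T k) (dper (T k) (fun x z a b => ∑' e, W k e x z a b)))) atTop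
      (𝓝 (tadpole A V)) := by
  rcases isEmpty_or_nonempty F with hF | ⟨⟨a₀⟩⟩
  · have h0 : ∀ k, Matrix.trace (perF (T k) A * perF (T k) (dper (T k) (fun x z a b => ∑' e, W k e x z a b))) = 0 := fun k => by
      rw [Matrix.trace]; simp [Finset.univ_eq_empty]
    have h1 : tadpole A V = 0 := by
      simp only [ExpKernelCalculus.tadpole, ExpKernelCalculus.tr, Finset.univ_eq_empty, Finset.sum_empty, tsum_zero]
    simp only [h0, h1]
    exact tendsto_const_nhds
  have hCA : 0 ≤ CA := hA.nonneg a₀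
  have hε0 : ∀ k e, 0 ≤ ε k e := fun k e => (hW k e).nonneg a₀
  have hγ : 0 < min α δ := lt_min hα hδ
  -- §1: the wound sum is bi-localised at `(p, q)` with the UNIFORM constant `Cε`
  have hWsum : ∀ k, BiLoc (fun x z a b => ∑' e, W k e x z a b) p q Cε δ := fun k x z a b =>
    (biLoc_tsum (hW k) (hεs k) x z a b).trans (mul_le_mul_of_nonneg_right (hεle k) (Real.exp_pos _).le)
  -- (i) the wrap-around: `trace(…) − tadpole A (wound sum) → 0`
  have hwrap : Tendsto (fun k => Matrix.trace (perF (T k) A * perF (T k) (dper (T k) (fun x z a b => ∑' e, W k e x z a b)))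
      - tadpole A (fun x z a b => ∑' e, W k e x z a b)) atTop (𝓝 0) := by
    refine tendsto_of_wrapAround T hT (half_pos (half_pos hγ))
      (K := (Fintype.card F : ℝ) * ((Fintype.card F : ℝ) * (CA * Cε) * Zl (d + 1) (min α δ - min α δ / 2)) *
        Real.exp (min α δ / 2 / 2 * l1 (p - q)) * (Zl (d + 1) (min α δ / 2 / 2) * latticeConst (d + 1) (min α δ / 2 / 2)))
      fun N k hk => ?_
    rw [sub_zero]
    exact abs_trace_tadpole_sub_tr_le (T k) hA hα (hAinv k) (hWsum k) hδ hk
  -- (ii) the tail: `tadpole A (wound sum) − tadpole A V → 0`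
  have hCt : ∀ k e, |tadpole A (W k e)| ≤
      ((Fintype.card F : ℝ) * ((Fintype.card F : ℝ) * CA * Zl (d + 1) (min α δ - min α δ / 2)) * Zl (d + 1) (min α δ / 2 / 2) *
        Real.exp (-(min α δ / 2 / 2) * l1 (p - q))) * ε k e := fun k e => by
    have h := abs_tadpole_le (decays_mono hA hCA le_rfl (min_le_left α δ)) (biLoc_mono (hW k e) (hε0 k e) (min_le_right α δ)) hγ
    refine h.trans (le_of_eq ?_)
    ring
  set Ct : ℝ := (Fintype.card F : ℝ) * ((Fintype.card F : ℝ) * CA * Zl (d + 1) (min α δ - min α δ / 2)) * Zl (d + 1) (min α δ / 2 / 2) *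
    Real.exp (-(min α δ / 2 / 2) * l1 (p - q)) with hCt_def
  have hCt0 : 0 ≤ Ct := by
    have hZ1 : 0 ≤ Zl (d + 1) (min α δ - min α δ / 2) := Zl_nonneg (by linarith)
    have hZ2 : 0 ≤ Zl (d + 1) (min α δ / 2 / 2) := Zl_nonneg (by positivity)
    rw [hCt_def]
    exact mul_nonneg (mul_nonneg (mul_nonneg (Nat.cast_nonneg _) (mul_nonneg (mul_nonneg (Nat.cast_nonneg _) hCA) hZ1)) hZ2)
      (Real.exp_pos _).le
  have htail : Tendsto (fun k => tadpole A (fun x z a b => ∑' e, W k e x z a b) - tadpole A V) atTop (𝓝 0) := by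
    have hlim : Tendsto (fun k => Ct * ∑' e, if e = 0 then (0 : ℝ) else ε k e) atTop (𝓝 0) := by
      simpa using hεlim.const_mul Ct
    refine squeeze_zero_norm (fun k => ?_) hlim
    obtain ⟨hs, heq⟩ := tadpole_tsum hA hα (hW k) (hεs k) hδ
    -- split off the `e = 0` member
    have hsplit : tadpole A (fun x z a b => ∑' e, W k e x z a b) - tadpole A V
        = ∑' e, if e = 0 then (0 : ℝ) else tadpole A (W k e) := by
      rw [heq, hs.tsum_eq_add_tsum_ite 0, hW0 k]
      ring
    rw [hsplit, Real.norm_eq_abs]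
    -- termwise domination of the tail by `Ct·ε k e`
    have hdom : Summable fun e : Fin (d + 1) → ℤ => Ct * (if e = 0 then (0 : ℝ) else ε k e) :=
      (((hεs k).of_nonneg_of_le (fun e => by split_ifs <;> simp [hε0 k e]) (fun e => by split_ifs <;> simp [hε0 k e])).mul_left Ct)
    have h := tsum_of_norm_bounded hdom.hasSum (f := fun e => if e = 0 then (0 : ℝ) else tadpole A (W k e)) (fun e => by
      rw [Real.norm_eq_abs]
      split_ifs
      · simp
      · exact hCt k e)
    rw [Real.norm_eq_abs, tsum_mul_left] at h
    exact h
  -- (iii) assemble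
  have h := (hwrap.add htail).add (tendsto_const_nhds (x := tadpole A V))
  rw [zero_add, zero_add] at h
  refine h.congr fun k => ?_
  ring

end Limit

/-! ## §4 The source-wound family under the adopted separation letter; the winding letter of the law v-next -/

section Translate

variable [Fintype F] {A : MKer (d + 1) F} {CA α : ℝ} {p q p₀ : Fin (d + 1) → ℤ} {Cw δ δs : ℝ}

omit [Fintype F] in
/-- [folklore] the separation vector of a wound source: `N•(s₀ + Mc∘e) − p₀ = (N•s₀ − p₀) + (N·Mc)∘e − 0`. -/
theorem zsmul_translate_sub (Mc : Fin (d + 1) → ℕ) (N : ℕ) (s₀ p₀ e : Fin (d + 1) → ℤ) :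
    (N : ℤ) • translate Mc s₀ e - p₀ = translate (fun i => N * Mc i) ((N : ℤ) • s₀ - p₀) e - 0 := by
  funext i
  simp only [Pi.sub_apply, Pi.smul_apply, translate_apply, smul_eq_mul, Pi.zero_apply, Nat.cast_mul, sub_zero]
  ring

/-- [folklore] **`tendsto_trace_tadpole_translate` — THE WINDING-LIMIT LEMMA (ii) (an2 g67 J-NOTE-8) UNDER THE ADOPTED SEPARATION LETTER.**  Torus boxes
`T k` and source boxes `Mc k` both growing, a decaying `T_kℤ`-invariant leg `A`, and a family of insertions `V s` (`s : ℤ^{d+1}` the second source)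
ALL bi-localised at `(p, q)`, rate `δ > 0`, with the first-source-localised separation constant `Cw·e^{−δs·|N•s − p₀|₁}` (`δs > 0`, blocking
`N ≥ 1`); then the torus tadpole trace of the SOURCE-WOUND family tends to the lattice tadpole of the unwound member:
`trace (perF (T k) A * perF (T k) (dper (T k) (x z a b ↦ Σ'_e V (s₀ + Mc_k∘e) x z a b))) → tadpole A (V s₀)`.
(§3 with `ε k e = |Cw|·e^{−δs·|(N•s₀ − p₀) + (N·Mc_k)∘e|₁}`: `Σ'_e ε k e ≤ |Cw|·K_{d+1}(δs)` by leaf-06 `summable_exp_l1_translate`; the `e ≠ 0` tail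
`≤ |Cw|·e^{δs|N•s₀ − p₀|₁}·K_{d+1}(δs∕2)·e^{−(δs∕2)·minᵢ Mc_k i}` by PART 15a `exp_neg_l1_translate_le_of_ne_zero`, null by leaf-06 `tendsto_of_wrapAround`.) -/
theorem tendsto_trace_tadpole_translate (T Mc : ℕ → (Fin (d + 1) → ℕ)) [∀ k μ, NeZero (T k μ)] [∀ k μ, NeZero (Mc k μ)]
    (hT : ∀ K : ℕ, ∀ᶠ k in atTop, ∀ i, K ≤ T k i) (hMc : ∀ K : ℕ, ∀ᶠ k in atTop, ∀ i, K ≤ Mc k i)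
    (hA : Decays A CA α) (hα : 0 < α)
    (hAinv : ∀ k (m x y : Fin (d + 1) → ℤ) (a b : F), A (translate (T k) x m) (translate (T k) y m) a b = A x y a b)
    (V : (Fin (d + 1) → ℤ) → MKer (d + 1) F) (s₀ : Fin (d + 1) → ℤ) (N : ℕ) [NeZero N]
    (hV : ∀ s, BiLoc (V s) p q (Cw * Real.exp (-δs * l1 ((N : ℤ) • s - p₀))) δ) (hδ : 0 < δ) (hδs : 0 < δs) :
    Tendsto (fun k => Matrix.trace (perF (T k) A * perF (T k) (dper (T k) (fun x z a b => ∑' e, V (translate (Mc k) s₀ e) x z a b))))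
      atTop (𝓝 (tadpole A (V s₀))) := by
  -- the separation vector of the `e`-th wound member, as a translate by the blown-up source box `N·Mc k`
  set x₀ : Fin (d + 1) → ℤ := (N : ℤ) • s₀ - p₀ with hx₀
  have hkey : ∀ k e, (N : ℤ) • translate (Mc k) s₀ e - p₀ = translate (fun i => N * Mc k i) x₀ e - 0 := fun k e =>
    zsmul_translate_sub (Mc k) N s₀ p₀ e
  -- the constants, enlarged to `|Cw|`
  set ε : ℕ → (Fin (d + 1) → ℤ) → ℝ := fun k e => |Cw| * Real.exp (-δs * l1 (translate (fun i => N * Mc k i) x₀ e - 0)) with hε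
  have hW : ∀ k e, BiLoc (V (translate (Mc k) s₀ e)) p q (ε k e) δ := fun k e x z a b => by
    refine (hV (translate (Mc k) s₀ e) x z a b).trans ?_
    rw [hkey k e]
    exact mul_le_mul_of_nonneg_right (mul_le_mul_of_nonneg_right (le_abs_self Cw) (Real.exp_pos _).le) (Real.exp_pos _).le
  have hsum : ∀ k, Summable (fun e => Real.exp (-δs * l1 (translate (fun i => N * Mc k i) x₀ e - 0))) ∧
      ∑' e, Real.exp (-δs * l1 (translate (fun i => N * Mc k i) x₀ e - 0)) ≤ latticeConst (d + 1) δs := fun k =>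
    summable_exp_l1_translate (fun i => N * Mc k i) hδs 0 x₀
  have hεs : ∀ k, Summable (ε k) := fun k => (hsum k).1.mul_left _
  have hεle : ∀ k, ∑' e, ε k e ≤ |Cw| * latticeConst (d + 1) δs := fun k => by
    rw [hε, tsum_mul_left]
    exact mul_le_mul_of_nonneg_left (hsum k).2 (abs_nonneg Cw)
  -- the `e ≠ 0` tail is one geometric series, null along `Mc`
  have hεlim : Tendsto (fun k => ∑' e, if e = 0 then (0 : ℝ) else ε k e) atTop (𝓝 0) := by
    refine tendsto_of_wrapAround Mc hMc (half_pos hδs)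
      (K := |Cw| * Real.exp (δs * l1 (x₀ - 0)) * latticeConst (d + 1) (δs / 2)) fun K k hk => ?_
    rw [sub_zero]
    have hMN : ∀ i, K ≤ N * Mc k i := fun i =>
      (hk i).trans (Nat.le_mul_of_pos_left (Mc k i) (Nat.pos_of_ne_zero (NeZero.ne N)))
    -- the lattice sum of the winding factors, uniformly bounded
    obtain ⟨hs2, hle2⟩ := summable_exp_l1_translate (fun i => N * Mc k i) (half_pos hδs) 0 0
    have hs2' : Summable fun e : Fin (d + 1) → ℤ =>
        Real.exp (-(δs / 2) * l1 (fun i => ((N * Mc k i : ℕ) : ℤ) * e i)) := by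
      refine hs2.congr fun e => ?_
      rw [translate_sub_self]
    have hle2' : ∑' e : Fin (d + 1) → ℤ, Real.exp (-(δs / 2) * l1 (fun i => ((N * Mc k i : ℕ) : ℤ) * e i))
        ≤ latticeConst (d + 1) (δs / 2) := by
      refine le_of_eq_of_le (tsum_congr fun e => ?_) hle2
      rw [translate_sub_self]
    -- termwise bound of the tail
    have hterm : ∀ e : Fin (d + 1) → ℤ, ‖(if e = 0 then (0 : ℝ) else ε k e)‖
        ≤ |Cw| * Real.exp (δs * l1 (x₀ - 0)) * Real.exp (-(δs / 2) * K) *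
          Real.exp (-(δs / 2) * l1 (fun i => ((N * Mc k i : ℕ) : ℤ) * e i)) := fun e => by
      rw [Real.norm_eq_abs]
      split_ifs with he
      · rw [abs_zero]; positivity
      · rw [hε, abs_of_nonneg (mul_nonneg (abs_nonneg _) (Real.exp_pos _).le), mul_assoc, mul_assoc]
        refine mul_le_mul_of_nonneg_left ?_ (abs_nonneg Cw)
        have h := exp_neg_l1_translate_le_of_ne_zero (fun i => N * Mc k i) hδs.le hMN x₀ 0 he
        simpa only [mul_assoc] using h
    have hmaj : Summable fun e : Fin (d + 1) → ℤ => |Cw| * Real.exp (δs * l1 (x₀ - 0)) * Real.exp (-(δs / 2) * K) *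
        Real.exp (-(δs / 2) * l1 (fun i => ((N * Mc k i : ℕ) : ℤ) * e i)) := hs2'.mul_left _
    have h := tsum_of_norm_bounded hmaj.hasSum hterm
    rw [Real.norm_eq_abs, tsum_mul_left] at h
    refine h.trans ?_
    have hC0 : 0 ≤ |Cw| * Real.exp (δs * l1 (x₀ - 0)) * Real.exp (-(δs / 2) * K) := by positivity
    calc |Cw| * Real.exp (δs * l1 (x₀ - 0)) * Real.exp (-(δs / 2) * K) *
          ∑' e : Fin (d + 1) → ℤ, Real.exp (-(δs / 2) * l1 (fun i => ((N * Mc k i : ℕ) : ℤ) * e i))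
        ≤ |Cw| * Real.exp (δs * l1 (x₀ - 0)) * Real.exp (-(δs / 2) * K) * latticeConst (d + 1) (δs / 2) :=
          mul_le_mul_of_nonneg_left hle2' hC0
      _ = |Cw| * Real.exp (δs * l1 (x₀ - 0)) * latticeConst (d + 1) (δs / 2) * Real.exp (-(δs / 2 * K)) := by
          rw [neg_mul]; ring
  have h := tendsto_trace_tadpole_tsum T hT hA hα hAinv (fun k e => V (translate (Mc k) s₀ e)) (V s₀)
    (fun k => by simp only [translate_zero]) ε hW hδ hεs hεle hεlim
  exact h

/-- [folklore] **`winding_letter_translate` — THE WINDING LETTER OF THE LAW v-NEXT, DISCHARGED IN SHAPE**: under the hypotheses of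
`tendsto_trace_tadpole_translate`, the torus tadpole traces of the source-wound family and of its unwound member differ by a null sequence:
`trace (perF (T k) A * perF (T k) (dper (T k) (Σ'_e V (s₀ + Mc_k∘e)))) − trace (perF (T k) A * perF (T k) (dper (T k) (V s₀))) → 0`
— the SHAPE of `TowerKernelLawNamedC.hessKer_law_tower_namedC`'s `hWNw ∕ hWFw ∕ hWGw` and of the END wrapper v5's `hWNw`
(§4 `.sub` leaf-06 `tendsto_trace_tadpole'`). -/
theorem winding_letter_translate (T Mc : ℕ → (Fin (d + 1) → ℕ)) [∀ k μ, NeZero (T k μ)] [∀ k μ, NeZero (Mc k μ)]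
    (hT : ∀ K : ℕ, ∀ᶠ k in atTop, ∀ i, K ≤ T k i) (hMc : ∀ K : ℕ, ∀ᶠ k in atTop, ∀ i, K ≤ Mc k i)
    (hA : Decays A CA α) (hα : 0 < α)
    (hAinv : ∀ k (m x y : Fin (d + 1) → ℤ) (a b : F), A (translate (T k) x m) (translate (T k) y m) a b = A x y a b)
    (V : (Fin (d + 1) → ℤ) → MKer (d + 1) F) (s₀ : Fin (d + 1) → ℤ) (N : ℕ) [NeZero N]
    (hV : ∀ s, BiLoc (V s) p q (Cw * Real.exp (-δs * l1 ((N : ℤ) • s - p₀))) δ) (hδ : 0 < δ) (hδs : 0 < δs) :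
    Tendsto (fun k => Matrix.trace (perF (T k) A * perF (T k) (dper (T k) (fun x z a b => ∑' e, V (translate (Mc k) s₀ e) x z a b)))
        - Matrix.trace (perF (T k) A * perF (T k) (dper (T k) (V s₀)))) atTop (𝓝 0) := by
  have h1 := tendsto_trace_tadpole_translate T Mc hT hMc hA hα hAinv V s₀ N hV hδ hδs
  have h2 := tendsto_trace_tadpole' T hT hA hα hAinv (hV s₀) hδ
  have h := h1.sub h2
  rwa [sub_self] at h

end Translate

end Summit.QuantumFields.BalabanUV.Beta.FP.KernelPeriodisationFibWoundLimit

end
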